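import Summits.CriticalPhenomena.PercolationContinuityZ3.Theorems.PercNearOneGluingNoHeavyLowerTailQ7PsiStarAll
import Summits.CriticalPhenomena.PercolationContinuityZ3.Theorems.PercNearOneGluingNoHeavyLowerTailQ7PsiGreen
import HarnessLib

/-!
# `NoHeavyLowerTail` (stmt-CriticalPhenomena-4575) — Kozma–Nitzan Question 7 for ANY number of relays when the
# observer is attached only to the relays and the target (designated form of Kozma–Nitzan's Theorem 4)

Support file (`--supports stmt-CriticalPhenomena-4575`), coupling seat `prim-cplus-coupling` (gen 5).  No
definitions, no named facts, no sorries.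

* `Q7Psi.q7_of_star` — **Theorem.**  Finite weighted graph; `A` a finite set of relays, `z ∈ A` the least
  `b`-reliable one (`μ(z↔b) ≤ μ(a↔b)` for all `a ∈ A`); observer `o ∉ A`, `o ≠ b`, `b ∉ A`, and every pair
  `s(o,u)` with `u ∉ A ∪ {b}` of weight `0`.  Then `μ({z↔b} ∩ {o↔A}) ≤ μ({o↔b} ∩ {o↔A})` — the pre-FKG
  inequality of Kozma–Nitzan's Question 7 (arXiv:2401.12397, p. 36) for the designated relay.  Kozma–Nitzan's
  Theorem 4 (pp. 12–14) is the MIN version ("some relay") on the same class of observers (there without the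
  `o–b` pair).  Proof: the peeled form (`Q7Psi.q7_of_psi`), the green bridge
  (`Q7Psi.real_inter_openConn_eq_integral_green`) and `Q7Psi.gpsi_star` on `G ∖ b`.
[cite: KozmaNitzan2024, Question 7 (p. 36), Theorem 4 and Lemma 5 (pp. 12–14), Lemma 3(ii) (pp. 6–7), §5.1 (pp. 31–32)]
-/

namespace Summit.CriticalPhenomena.PercolationContinuityZ3.Theorems

open MeasureTheory Set Literature.Probability.LatticeModels Literature.Probability.Percolation
open scoped Classical
open KNPreFKG

noncomputable section

namespace Q7Psi

variable {V : Type*} [Fintype V]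

/-- **Kozma–Nitzan's Question 7, observer attached only to `A ∪ {b}`, any `|A|`.**
[cite: KozmaNitzan2024, Question 7 (p. 36), Theorem 4 (pp. 12–14)] -/
theorem q7_of_star (w : Sym2 V → unitInterval) (o b z : V) (A : Finset V) (hob : o ≠ b) (hoA : o ∉ A)
    (hbA : b ∉ A) (hzA : z ∈ A) (hiso : ∀ u, u ≠ o → u ∉ insert b A → w s(o, u) = 0)
    (hz : ∀ a ∈ A, (prodBernoulli w).real (openConn z b) ≤ (prodBernoulli w).real (openConn a b)) :
    (prodBernoulli w).real (openConn z b ∩ ⋃ a ∈ A, openConn o a) ≤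
      (prodBernoulli w).real (openConn o b ∩ ⋃ a ∈ A, openConn o a) := by
  set μ := prodBernoulli w with hμ
  have hmeas : ∀ T : Set (BondConfig V), MeasurableSet T := fun _ => MeasurableSet.of_discrete
  have hab : ∀ a ∈ A, a ≠ b := fun a ha h => hbA (h ▸ ha)
  have hao : ∀ a ∈ A, a ≠ o := fun a ha h => hoA (h ▸ ha)
  have hzb : z ≠ b := hab z hzA
  have hzo : z ≠ o := hao z hzA
  -- (1) reduction to the peeled form
  refine q7_of_psi w o b z A ?_
  set A₀ : Finset V := A.erase z with hA₀
  set J' : Set (BondConfig V) := ⋃ a ∈ A₀, openConnIn ({b}ᶜ : Set V) o a with hJ'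
  set Jz : Set (BondConfig V) := openConnIn ({b}ᶜ : Set V) o z with hJz
  have hJ : ∀ X : Set (BondConfig V), X ∩ (⋃ a ∈ A, openConnIn ({b}ᶜ : Set V) o a) = X ∩ (J' ∪ Jz) := by
    intro X; congr 1; ext ω
    simp only [hJ', hJz, hA₀, mem_iUnion, mem_union, exists_prop, Finset.mem_erase]
    constructor
    · rintro ⟨a, ha, h⟩
      by_cases haz : a = z
      · subst haz; exact Or.inr h
      · exact Or.inl ⟨a, ⟨haz, ha⟩, h⟩
    · rintro (⟨a, ⟨-, ha⟩, h⟩ | h)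
      · exact ⟨a, ha, h⟩
      · exact ⟨z, hzA, h⟩
  rw [hJ, hJ]
  -- (2) the `z`-part contributes equally
  have msplit : ∀ X : Set (BondConfig V), μ.real (X ∩ (J' ∪ Jz)) = μ.real (X ∩ J') + μ.real (X ∩ Jz ∩ J'ᶜ) := by
    intro X
    have hdj : Disjoint (X ∩ J') (X ∩ Jz ∩ J'ᶜ) := by
      rw [Set.disjoint_left]; rintro ω ⟨-, h⟩ ⟨-, hn⟩; exact hn h
    rw [← measureReal_union hdj (hmeas _)]
    congr 1; ext ω; simp only [mem_inter_iff, mem_union, mem_compl_iff]; tauto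
  have hz_eq : openConn z b ∩ Jz ∩ J'ᶜ = openConn o b ∩ Jz ∩ J'ᶜ := by
    ext ω; simp only [mem_inter_iff]
    constructor
    · rintro ⟨⟨hzb', hJ⟩, hn⟩; exact ⟨⟨(reachable_of_openConnIn hJ).trans hzb', hJ⟩, hn⟩
    · rintro ⟨⟨hob', hJ⟩, hn⟩; exact ⟨⟨(reachable_of_openConnIn hJ).symm.trans hob', hJ⟩, hn⟩
  rw [msplit, msplit, hz_eq]
  suffices key : μ.real (openConn z b ∩ J') ≤ μ.real (openConn o b ∩ J') by linarith
  -- (3) pass to `G ∖ b`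
  set S : Set V := {b}ᶜ with hS
  haveI : Fintype S := Fintype.ofFinite S
  set r := restrictConfig (Subtype.val : S → V) with hr
  set w' : Sym2 S → unitInterval := w ∘ Sym2.map (Subtype.val : S → V) with hw'
  set μ' := prodBernoulli w' with hμ'
  set o' : S := ⟨o, mem_compl_singleton_iff.2 hob⟩ with ho'
  set z' : S := ⟨z, mem_compl_singleton_iff.2 hzb⟩ with hz'
  set A' : Finset S := A₀.subtype (fun v => v ∈ S) with hA'
  have hA'mem : ∀ a' : S, a' ∈ A' ↔ (a' : V) ∈ A₀ := fun a' => by simp [hA', Finset.mem_subtype]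
  set E : Set (BondConfig S) := ⋃ a' ∈ A', (openConn o' a' : Set (BondConfig S)) with hE
  have hJE : J' = r ⁻¹' E := by
    ext ω
    simp only [hJ', hE, mem_iUnion, mem_preimage, exists_prop]
    constructor
    · rintro ⟨a, ha, h⟩
      have haS : a ∈ S := mem_compl_singleton_iff.2 (hab a (Finset.mem_of_mem_erase ha))
      refine ⟨⟨a, haS⟩, (hA'mem _).2 ha, ?_⟩
      exact (reachable_restrictConfig_val_iff S ω o' ⟨a, haS⟩).2 h
    · rintro ⟨a', ha', h⟩
      exact ⟨a', (hA'mem a').1 ha', (reachable_restrictConfig_val_iff S ω o' a').1 h⟩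
  -- the green function
  set F : Set S → ℝ := fun T => μ.real {ω₁ : BondConfig V | ∃ s ∈ Subtype.val '' T, s ≠ b ∧ s(b, s) ∈ ω₁} with hF
  have hFmono : ∀ T T' : Set S, T ⊆ T' → F T ≤ F T' := by
    intro T T' hTT'
    refine measureReal_mono fun ω₁ hω₁ => ?_
    obtain ⟨s, hs, hsb, hso⟩ := hω₁
    exact ⟨s, image_mono hTT' hs, hsb, hso⟩
  have hbridge : ∀ (v : V) (hvb : v ≠ b) (E₁ : Set (BondConfig S)),
      μ.real (openConn v b ∩ r ⁻¹' E₁) = ∫ ω' in E₁, F (openCluster ω' ⟨v, mem_compl_singleton_iff.2 hvb⟩) ∂μ' := by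
    intro v hvb E₁
    rw [inter_comm, hr, real_inter_openConn_eq_integral_green w b v hvb E₁, ← integral_indicator (hmeas _),
      hμ', hw', ← integral_indicator (MeasurableSet.of_discrete), ← integral_comp_restrictConfig_val]
    refine integral_congr_ae (Filter.Eventually.of_forall fun ω => ?_)
    change (restrictConfig Subtype.val ⁻¹' E₁).indicator _ ω = E₁.indicator _ (restrictConfig Subtype.val ω)
    have hfun : (fun ω : BondConfig V => μ.real {ω₁ : BondConfig V | ∃ s ∈ {y | ω ∈ openConnIn ({b}ᶜ : Set V) v y},
        s ≠ b ∧ s(b, s) ∈ ω₁}) =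
        (fun ω' => F (openCluster ω' ⟨v, mem_compl_singleton_iff.2 hvb⟩)) ∘ restrictConfig (Subtype.val : S → V) := by
      funext ω
      simp only [Function.comp_apply, hF]
      rw [setOf_openConnIn_eq_image b ω ⟨v, mem_compl_singleton_iff.2 hvb⟩]
    rw [hfun]
    exact indicator_comp_right _
  have htau : ∀ (v : V) (hvb : v ≠ b), μ.real (openConn v b) =
      ∫ ω', F (openCluster ω' ⟨v, mem_compl_singleton_iff.2 hvb⟩) ∂μ' := by
    intro v hvb
    rw [← setIntegral_univ, ← hbridge v hvb univ, preimage_univ, inter_univ]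
  have hyp' : ∀ a' ∈ A', ∫ ω', F (openCluster ω' z') ∂μ' ≤ ∫ ω', F (openCluster ω' a') ∂μ' := by
    intro a' ha'
    have haA : (a' : V) ∈ A := Finset.mem_of_mem_erase ((hA'mem a').1 ha')
    have h := hz a' haA
    rw [htau z hzb, htau a' (hab _ haA)] at h
    exact h
  have hzo' : z' ≠ o' := fun h => hzo (congrArg Subtype.val h)
  have hoA' : o' ∉ A' := fun h => hoA (Finset.mem_of_mem_erase ((hA'mem o').1 h))
  have hzA' : z' ∉ A' := fun h => by
    have := (hA'mem z').1 h
    exact (Finset.mem_erase.1 this).1 rfl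
  rw [hJE, hbridge z hzb E, hbridge o hob E]
  refine gpsi_star w' o' z' A' hoA' hzA' hzo' ?_ F hFmono hyp'
  -- the star hypothesis on `G ∖ b`
  intro u huo hu
  have huo' : (u : V) ≠ o := fun h => huo (Subtype.ext h)
  have hub : (u : V) ≠ b := mem_compl_singleton_iff.1 u.2
  refine hiso u huo' ?_
  rw [Finset.mem_insert, not_or]
  refine ⟨hub, fun huA => hu ?_⟩
  by_cases huz : (u : V) = z
  · exact (@Finset.mem_insert _ (fun a b => Classical.propDecidable (a = b)) _ _ _).2 (Or.inl (Subtype.ext huz))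
  · exact (@Finset.mem_insert _ (fun a b => Classical.propDecidable (a = b)) _ _ _).2
      (Or.inr ((hA'mem u).2 (Finset.mem_erase.2 ⟨huz, huA⟩)))

end Q7Psi

end

end Summit.CriticalPhenomena.PercolationContinuityZ3.Theorems
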